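import Summits.ABC.ABC.Theses.RibetTakahashiSplit
import Summits.ABC.ABC.Theorems.RibetTakahashiSplitWeightedSzpiroBoundAbc
import HarnessLib

/-!
# Route RibetTakahashiSplit — the rev-12 assembly chain (former item `Assembly3`, stmt-ABC-15175)

The rev-12 assembly of the route, with the many-prime crux re-cut to the SEMISTABLE
Frey–Hellegouarch class (`ManyPrimeValuationProductSemistableFrey`, stmt-ABC-15174):

> `ManyPrimeValuationProductSemistableFrey → FewPrimeValuationProduct → WeightedSzpiroBound → ABC`.

It is proved on the nose from `Summit.ABC.ABC.Theorems.WeightedSzpiroBound.abc_of`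
(`Theorems/RibetTakahashiSplitWeightedSzpiroBoundAbc.lean`): the weighted Szpiro bound
r3′ = `WeightedSzpiroBound` alone already gives `ABC` (the component weight
`T(E) = ∏_{p ∥ N} ord_p Δ_min ≤ K_η |Δ|^η` is absorbed into the exponent).

History: this file originally targeted the route decl
`Summit.ABC.ABC.Theses.RibetTakahashiSplit.Assembly3` (item stmt-ABC-15175, closed as proved by
`ribetTakahashiSplit_assembly3_proof` at commit 54df80d7053a). The gate's LINT AUTOFIX of
2026-08-16T14:15:59Z dropped that decl from the route file (duplicate assembly; the route's `closes`
goes through `Assembly`, and the current `Assembly2` is the ω-lift chain stmt-ABC-15513; the item's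
proved record is unchanged), after which the old statement no longer elaborated. The chain is
therefore stated here VERBATIM (the dropped decl's body, by the route's decl names) as
`abc_of_semistableFrey_fewPrime_weightedSzpiro` — same proposition, same proof — and the old name
survives as its deprecated alias (the ledger's `closed_by` record of stmt-ABC-15175).

Honest note (carried over from `Assembly` / `Assembly2`): the cruxes
R2 = `ManyPrimeValuationProductSemistableFrey` and r4 = `FewPrimeValuationProduct` enter this chain
vacuously — they carry the route's valuation-product MECHANISM and its milestones
(`SubexpABCManyPrimes`, `AbcValuationProduct`), not the formal deduction of `ABC`, which r3′ alone
gives.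

Nothing else is in this file (no definitions, no named facts).
-/

-- `Summit.<Summit>.<Problem>` is the mandated summit-side namespace (CONVENTIONS §2); for the
-- single-conjunct summit `ABC` the two coincide, so the duplicate `ABC.ABC` is deliberate.
set_option linter.dupNamespace false

noncomputable section

namespace Summit.ABC.ABC.Theorems

open Summit.ABC.ABC.Theses

/-- **The rev-12 assembly chain (former item stmt-ABC-15175, `Assembly3`), proved.**
`ManyPrimeValuationProductSemistableFrey → FewPrimeValuationProduct → WeightedSzpiroBound → ABC`
(stated verbatim; the route decl `Assembly3` it used to unfold was dropped from the route file
2026-08-16): discard the first two hypotheses and apply `WeightedSzpiroBound.abc_of` to the third.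
[folklore] -/
theorem abc_of_semistableFrey_fewPrime_weightedSzpiro :
    RibetTakahashiSplit.ManyPrimeValuationProductSemistableFrey →
      RibetTakahashiSplit.FewPrimeValuationProduct →
        RibetTakahashiSplit.WeightedSzpiroBound → _root_.ABC :=
  fun _ _ hW => WeightedSzpiroBound.abc_of hW

/-- Deprecated name of `abc_of_semistableFrey_fewPrime_weightedSzpiro` (it was stated against the
route decl `Summit.ABC.ABC.Theses.RibetTakahashiSplit.Assembly3`, dropped from the route file
2026-08-16; it remains the ledger's `closed_by` record of item stmt-ABC-15175). [folklore] -/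
@[deprecated abc_of_semistableFrey_fewPrime_weightedSzpiro (since := "2026-08-16")]
alias ribetTakahashiSplit_assembly3_proof := abc_of_semistableFrey_fewPrime_weightedSzpiro

end Summit.ABC.ABC.Theorems

end
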